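import Summits.AtomisticToContinuum.Crystallization.Theses.NashClassCertificates
import Summits.AtomisticToContinuum.Crystallization.Theorems.PhononSlackCertificatesHullBridgeCleanCentres
import Summits.AtomisticToContinuum.Crystallization.Theorems.PhononSlackCertificatesHullBridgeWindowsOfGluing
import Summits.AtomisticToContinuum.Crystallization.Theorems.ReggeStarCoercivityDefectFreeCrystallizesLayeredGluing
import Summits.AtomisticToContinuum.Crystallization.Theorems.ReggeStarCoercivityZeroDefectDensityTwoShell

/-!
# Birth skeleton (BC3) — crux `NashHullBridge` (stmt-AtomisticToContinuum-16828), line `birth`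

Route `route-AtomisticToContinuum-NashClassCertificates` (sub-problem `Crystallization`), crux decl
`Summit.AtomisticToContinuum.Crystallization.Theses.NashClassCertificates.NashHullBridge :
NashTwoShellGap → NashNearField → (layered windows of every Lennard-Jones ground-state sequence)` — the
BRIDGE ON THE NASH CLASS (rank 9, difficulty M): the port of the PROVED all-configuration bridge
`PhononSlackCertificates.HullBridge` (stmt-15147, `Theorems.HullBridgeExact.hullBridge_proof =
hullBridge_of_layeredGluing PrestressSplitKorn.stub_layeredGluing`) to antecedents that are quantified over
`1/3`-separated NASH configurations only.

## The line

`hullBridge_of_layeredGluing` composes four landed soft stubs S1 `stub_badFraction`, S2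
`stub_nonLayeredFraction`, S3 `stub_cleanCentres`, S5 `stub_windowsOfGluing` with the landed gluing lemma
`PrestressSplitKorn.stub_layeredGluing`. Only S1 and S2 ever touch the two certificate antecedents, and they
apply them to the ground states `x N` themselves — which are `1/3`-separated
(`ZeroDefectDensity.third_le_dist_of_isGroundState`) and NASH (one-particle move: no particle of a minimiser
lowers the energy by relocating; route support item `GroundStatesAreNash`, stmt-16830). So the port has exactly
three ingredients, the three stubs below; S3, S5 and the gluing lemma are potential-free and certificate-free and are
used AS LANDED in the composition.

| stub | statement | size / status |
|---|---|---|
| `stub_groundStatesAreNash` | the route support item `GroundStatesAreNash` BY NAME (stmt-16830): every LJ ground state is Nash — `siteEnergy x i ≤ Σ_{j≠i} V(|y − x_j|)` for every free point `y` | S; provable now (update `x i y` is an injective competitor, `two_mul_interactionEnergy`; the planner's Sketch had it sorry-free) |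
| `stub_nashBadFraction` | `Goal.stub_nashBadFraction` — S1 ON THE NASH CLASS: `NashTwoShellGap` + (`x N` ground states, each Nash) ⟹ `#{i : ¬ IsTwoShellGood (1/20) (47/50) 1 (x N) i}/N → 0` | S; port of `HullBridgeExact.stub_badFraction` at `δ = 1/3` (`third_le_dist_of_isGroundState`, `PrestressSplitKorn.squeeze_tendsto_excess_div`, `HullBridgeExact.bf_div_le`) |
| `stub_nashNonLayeredFraction` | `Goal.stub_nashNonLayeredFraction` — S2 ON THE NASH CLASS: `NashNearField` + (`x N` ground states, each Nash) + bad fraction `→ 0` ⟹ for every `η > 0`, `#{i : ¬ LayeredNear η (x N) i}/N → 0` | M; port of `HullBridgeExact.stub_nonLayeredFraction` at `δ = 1/3` (`nl_card_inline_eq`, `nl_card_bdry_eq`, `nl_ineq` are `δ`-generic and reusable verbatim) |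

## Composition (§3; kernel-checked, no sorry below §2)

`NashHullBridge_of (h₀ : GroundStatesAreNash) (h₁ : Goal.stub_nashBadFraction) (h₂ : Goal.stub_nashNonLayeredFraction) :
NashHullBridge` — intro the two certificates and a ground-state sequence `x`; `h₀` gives the per-`N` Nash
property `hN`; `h₁ _ x hx hN` is the vanishing bad fraction; `HullBridgeExact.stub_cleanCentres` (landed S3) fed
with `h₂ _ x hx hN hbad` gives clean `(η, R')`-centres eventually; `HullBridgeExact.stub_windowsOfGluing` (landed
S5) with `PrestressSplitKorn.stub_layeredGluing` (landed gluing lemma) returns the matrix of `NashHullBridge`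
verbatim. All three hypotheses are load-bearing (`h₀` inside the Nash arguments of `h₁`, `h₂`).
`NashHullBridge_of_stubs : NashHullBridge` = `_of` applied to the three stubs (crux BY NAME, no hypotheses;
`sorryAx` is reached exactly through `stub_*`).

## Disproof / negatives used

None relevant: the crux directory was empty at registration (no `Disproof.lean`, no ideas, no lines —
`ledger crux ls stmt-AtomisticToContinuum-16828`, 2026-08-17); `ledger negatives` has no statement about the
bridge; the route file rates the item "only bookkeeping of the port". A grounder's candidate proof of the whole
crux is attached to the item as evidence (NashHullBridge16828.lean, rc 0 per its note; not readable from this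
seat), with the same three ingredients.

## BC3 probes (registrar folder `bc/`; every probe FAILS as required — see `Lines/birth.md`)

For each stub statement `S ∈ {GroundStatesAreNash, Goal.stub_nashBadFraction, Goal.stub_nashNonLayeredFraction}`:
`S → NashHullBridge` and `S → _root_.Crystallization` by `exact?` / `simpa` / `simpa [S]` / `(unfold S; simpa)` /
`aesop` (maxHeartbeats 400000) all fail.

planner-skel-stmt-AtomisticToContinuum-16828-0 (skeleton-register, 2026-08-17).
-/

noncomputable section

open scoped BigOperators Classical
open Filter Topology

namespace Summit.AtomisticToContinuum.Crystallization.Cruxes.NashHullBridge.Birth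

open Summit.AtomisticToContinuum.Crystallization.Theses.NashClassCertificates
open Summit.AtomisticToContinuum.Crystallization.Theorems.PrestressSplitKorn (LayeredNear LayeredGluing)
open Summit.AtomisticToContinuum.Crystallization.Theorems.DefectFreeCrystallizes.Negative.PredicateAPI (Good)
open Literature.MathematicalPhysics.StatisticalMechanics Literature.Geometry.DiscreteGeometry

/-! ## §1 Stub statements (plain `Prop`s over tree vocabulary; the admissible hypotheses of `NashHullBridge_of`) -/

/-- **Goal of stub S1-Nash, `stub_nashBadFraction` — the bad fraction vanishes along Nash ground states.**
`NashTwoShellGap` (one `g > 0` pricing every `1/20`-bad particle of a `1/3`-separated NASH configuration at `g`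
above `N·e*`), applied to the ground states `x N` (which are `1/3`-separated by
`ZeroDefectDensity.third_le_dist_of_isGroundState` and Nash by the hypothesis), together with the `o(N)` energy
budget `(E(x N) − N·e*)/N → 0` (`PrestressSplitKorn.squeeze_tendsto_excess_div`, i.e. the proved
`crysEnergyLimit`), gives `#{i : ¬ IsTwoShellGood (1/20) (47/50) 1 (x N) i}/N ≤ ((E − N e*)/N)/g → 0`.
[cite: BlancLewin2015, §2.2] -/
def Goal.stub_nashBadFraction : Prop :=
  NashTwoShellGap →
    ∀ x : (N : ℕ) → (Fin N → EuclideanSpace ℝ (Fin 3)),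
      (∀ N, IsGroundState lennardJones (x N)) →
      (∀ (N : ℕ) (i : Fin N) (y : EuclideanSpace ℝ (Fin 3)), (∀ j : Fin N, j ≠ i → y ≠ x N j) →
        siteEnergy lennardJones (x N) i ≤ ∑ j ∈ Finset.univ.erase i, lennardJones (dist y (x N j))) →
      Tendsto (fun N : ℕ =>
        (Nat.card {i : Fin N // ¬ IsTwoShellGood (1 / 20) (47 / 50) 1 (x N) i} : ℝ) / N) atTop (𝓝 0)

/-- **Goal of stub S2-Nash, `stub_nashNonLayeredFraction` — the non-layered fraction vanishes along Nash
ground states.** `NashNearField` at a fixed tolerance `η`, applied to the (`1/3`-separated, Nash) ground state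
`x N` with `Ω :=` its two-shell-good sites, bounds `c · #{i : ¬ LayeredNear η (x N) i}` by the total excess
`E(x N) − N·e*` (`o(N)`) plus `K · #{i : ¬ 1/20-good}` (boundary layer of depth `4` by packing, half site energies
`≥ −(125/6)·3⁶` on bad sites: `HullBridgeExact.nl_ineq` at `δ = 1/3`; the inline `η`-layered predicate of
`NashNearField` IS `LayeredNear`, `HullBridgeExact.nl_card_inline_eq`). Hence once the bad fraction vanishes so
does the non-`η`-layered fraction. [cite: BlancLewin2015, §2.2] -/
def Goal.stub_nashNonLayeredFraction : Prop :=
  NashNearField →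
    ∀ x : (N : ℕ) → (Fin N → EuclideanSpace ℝ (Fin 3)),
      (∀ N, IsGroundState lennardJones (x N)) →
      (∀ (N : ℕ) (i : Fin N) (y : EuclideanSpace ℝ (Fin 3)), (∀ j : Fin N, j ≠ i → y ≠ x N j) →
        siteEnergy lennardJones (x N) i ≤ ∑ j ∈ Finset.univ.erase i, lennardJones (dist y (x N j))) →
      Tendsto (fun N : ℕ =>
        (Nat.card {i : Fin N // ¬ IsTwoShellGood (1 / 20) (47 / 50) 1 (x N) i} : ℝ) / N) atTop (𝓝 0) →
      ∀ η : ℝ, 0 < η → Tendsto (fun N : ℕ =>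
        ((Finset.univ.filter fun i : Fin N => ¬ LayeredNear η (x N) i).card : ℝ) / N) atTop (𝓝 0)

/-! ## §2 Stubs (the ONLY sorries of the file) -/

/-- Stub 0 (S; provable now): **ground states are Nash** — the route support item `GroundStatesAreNash`
(stmt-AtomisticToContinuum-16830) BY NAME: for every LJ ground state `x`, every `i` and every point `y` distinct
from the other particles, `siteEnergy x i ≤ Σ_{j≠i} V(|y − x_j|)` (the relocated configuration `update x i y` is
an injective competitor, so its energy is `≥ E(N) = 𝓔(x)`; `two_mul_interactionEnergy`).
[cite: BlancLewin2015, §2.2] -/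
theorem stub_groundStatesAreNash : GroundStatesAreNash := by
  sorry

/-- Stub 1 (S; port of `HullBridgeExact.stub_badFraction` at `δ = 1/3`): **S1 on the Nash class**. -/
theorem stub_nashBadFraction :
    NashTwoShellGap →
      ∀ x : (N : ℕ) → (Fin N → EuclideanSpace ℝ (Fin 3)),
        (∀ N, IsGroundState lennardJones (x N)) →
        (∀ (N : ℕ) (i : Fin N) (y : EuclideanSpace ℝ (Fin 3)), (∀ j : Fin N, j ≠ i → y ≠ x N j) →
          siteEnergy lennardJones (x N) i ≤ ∑ j ∈ Finset.univ.erase i, lennardJones (dist y (x N j))) →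
        Tendsto (fun N : ℕ =>
          (Nat.card {i : Fin N // ¬ IsTwoShellGood (1 / 20) (47 / 50) 1 (x N) i} : ℝ) / N) atTop (𝓝 0) := by
  sorry

/-- Stub 2 (M; port of `HullBridgeExact.stub_nonLayeredFraction` at `δ = 1/3`): **S2 on the Nash class**. -/
theorem stub_nashNonLayeredFraction :
    NashNearField →
      ∀ x : (N : ℕ) → (Fin N → EuclideanSpace ℝ (Fin 3)),
        (∀ N, IsGroundState lennardJones (x N)) →
        (∀ (N : ℕ) (i : Fin N) (y : EuclideanSpace ℝ (Fin 3)), (∀ j : Fin N, j ≠ i → y ≠ x N j) →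
          siteEnergy lennardJones (x N) i ≤ ∑ j ∈ Finset.univ.erase i, lennardJones (dist y (x N j))) →
        Tendsto (fun N : ℕ =>
          (Nat.card {i : Fin N // ¬ IsTwoShellGood (1 / 20) (47 / 50) 1 (x N) i} : ℝ) / N) atTop (𝓝 0) →
        ∀ η : ℝ, 0 < η → Tendsto (fun N : ℕ =>
          ((Finset.univ.filter fun i : Fin N => ¬ LayeredNear η (x N) i).card : ℝ) / N) atTop (𝓝 0) := by
  sorry

/-! ## §3 Composition (kernel-checked; no sorry below this line) -/

/-- **The line closes the crux modulo its three stubs** (`NashHullBridge` BY NAME; real proof). Intro the two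
Nash-class certificates and a ground-state sequence `x`; `h₀` makes every `x N` Nash (`hN`); `h₁` gives the
vanishing bad fraction; the LANDED clean-centres step `HullBridgeExact.stub_cleanCentres`, fed with `h₂`, gives
clean `(η, R')`-centres for all large `N`; the LANDED windows step `HullBridgeExact.stub_windowsOfGluing` with the
LANDED gluing lemma `PrestressSplitKorn.stub_layeredGluing` returns the matrix of `NashHullBridge` verbatim.
[cite: BlancLewin2015, §2.2] -/
theorem NashHullBridge_of (h₀ : GroundStatesAreNash) (h₁ : Goal.stub_nashBadFraction)
    (h₂ : Goal.stub_nashNonLayeredFraction) :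
    Summit.AtomisticToContinuum.Crystallization.Theses.NashClassCertificates.NashHullBridge := by
  intro hTG hNF x hx
  -- every ground state of the sequence is Nash (stub 0)
  have hN : ∀ (N : ℕ) (i : Fin N) (y : EuclideanSpace ℝ (Fin 3)), (∀ j : Fin N, j ≠ i → y ≠ x N j) →
      siteEnergy lennardJones (x N) i ≤ ∑ j ∈ Finset.univ.erase i, lennardJones (dist y (x N j)) :=
    fun N => h₀ N (x N) (hx N)
  -- S1-Nash: the bad fraction vanishes
  have hbad : Tendsto (fun N : ℕ =>
      (Nat.card {i : Fin N // ¬ IsTwoShellGood (1 / 20) (47 / 50) 1 (x N) i} : ℝ) / N) atTop (𝓝 0) :=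
    h₁ hTG x hx hN
  -- S2-Nash: the non-`η`-layered fraction vanishes for every `η > 0`
  have hnl : ∀ η : ℝ, 0 < η → Tendsto (fun N : ℕ =>
      ((Finset.univ.filter fun i : Fin N => ¬ LayeredNear η (x N) i).card : ℝ) / N) atTop (𝓝 0) :=
    h₂ hNF x hx hN hbad
  -- landed S3 (clean centres), S5 (windows of gluing) and the landed gluing lemma
  exact Summit.AtomisticToContinuum.Crystallization.Theorems.HullBridgeExact.stub_windowsOfGluing
    Summit.AtomisticToContinuum.Crystallization.Theorems.PrestressSplitKorn.stub_layeredGluing x hx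
    (fun η hη R' =>
      Summit.AtomisticToContinuum.Crystallization.Theorems.HullBridgeExact.stub_cleanCentres x hx hbad hnl hη R')

/-- **Registered target of the skeleton** — the crux BY NAME with no hypotheses: `NashHullBridge_of` applied
to the three declared stubs (kernel check that the stub signatures ARE the hypotheses of `_of`; the sorries live
in `stub_*` only). [cite: BlancLewin2015, §2.2] -/
theorem NashHullBridge_of_stubs :
    Summit.AtomisticToContinuum.Crystallization.Theses.NashClassCertificates.NashHullBridge :=
  NashHullBridge_of stub_groundStatesAreNash stub_nashBadFraction stub_nashNonLayeredFraction

end Summit.AtomisticToContinuum.Crystallization.Cruxes.NashHullBridge.Birth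

end
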